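import Summits.CriticalPhenomena.PercolationContinuityZ3.Theorems.Transplant.FKConnectivityAllQAntipodalLevel4
import HarnessLib

/-!
# Connectivity correlation inequalities for `φ_{w,q}`, every `q > 0` — file 35: **`C_∞` AT LEVEL ≤ 3 FOR EVERY INCREASING
# `f` (top cell)** — the odd-vector reduction and the level-3 cone

Support file (`--supports stmt-CriticalPhenomena-4575`), FK sub-lane `prim-bschramm-fk-2` (gen 20); builds on p205010 (kernel theorem,
internal audit signed; external expert review pending).  No definitions, no named facts, no sorries; standard axioms.

Gen 10's Conjecture `C_∞` (top cell): on a 2-connected series–parallel graph `H`, for `0 < q ≤ 1` and increasing `f, g` reading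
DISJOINT edge sets, the antipodal covariance form `apPsi q H f g = Σ_{γ ⊆ H} q^{k(γ)+k(H∖γ)} (f γ − f(H∖γ))(g γ − g(H∖γ))` (twice the
square-free top coefficient of `Z_H² Cov_{φ_{z,q}}(f,g)`) is `≤ 0`.  Gens 11–19 typed it for NAMED types of `f` (one edge = Theorem U,
two edges, `maj₃`, `and_T` for every `T` (file 32c), U¹¹ (gen 16), the threshold events on four edges (file 34)).  THIS FILE proves it for
EVERY increasing `f` reading at most three edges `x, y, z` of `H` — i.e. `C_∞` whenever `min(|supp f|, |supp g|) ≤ 3` — WITHOUT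
enumerating the twenty monotone Boolean functions of three variables:
* `FK.apPsi_congr_odd` — `apPsi` sees only the odd part `γ ↦ f γ − f(H∖γ)` of `f`;  `FK.apPsi_comm` — and is symmetric in `f, g`;
* `FK.apPsi_level3_eq` — THE ODD-VECTOR REDUCTION: if `f` reads only `S = {x,y,z} ⊆ H` then, with `d∅ = f S − f ∅`, `dx = f{x} − f{y,z}`,
  `dy = f{y} − f{x,z}`, `dz = f{z} − f{x,y}` and the AND functionals `a_T = apPsi q H 1_{T ⊆ ·} g`,
  `apPsi q H f g = (d∅ + dx + dy + dz)·a_S − dx·a_{yz} − dy·a_{xz} − dz·a_{xy}`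
  (the odd part of `f` on the eight patterns `γ ∩ S` is that of `(d∅+dx+dy+dz)1_S − dx 1_{yz} − dy 1_{xz} − dz 1_{xy}`): at level 3 EVERY
  antipodal functional is a combination of the four AND functionals `a_{xyz}, a_{xy}, a_{xz}, a_{yz}`;
* `FK.apPsi_pivot_eq_ands` (`a_x = a_{xy} + a_{xz} − a_{yz}`: Theorem U is a relation among AND functionals) and
  `FK.apPsi_pivot_split_eq_ands` (`U¹¹_{x;yz} = a_{xy} + a_{xz} − 2a_{xyz}`: gen 16's U¹¹ says `a_{xy} + a_{xz} ≤ 2 a_{xyz}`);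
* `FK.level3_cone` — real arithmetic: the ten inequalities `a_T ≤ 0`, `a_x, a_y, a_z ≤ 0`, `U¹¹_x, U¹¹_y, U¹¹_z ≤ 0` and the
  monotonicity constraints `|d_i| ≤ d∅`, `d_i + d_j ≤ 0` imply `(d∅+dx+dy+dz)a_S − dx a_{yz} − dy a_{xz} − dz a_{xy} ≤ 0` (a four-case
  argument on which of the 'drifts' `a_S − a_T` is negative — at most one, by U¹¹);
* **`FK.apPsi_level3_nonpos_of_isTTSP`**: `E` two-terminal series–parallel between `s, t`, `st ∉ E`, `x, y, z ∈ H = E ∪ {st}` distinct,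
  `0 < q ≤ 1`, `f` increasing reading only `x, y, z`, `g` increasing on the sub-configurations of `H` reading none of them ⟹
  `apPsi q H f g ≤ 0`; **`FK.apPsi_level3_nonpos_of_isTTSP'`** — the same with the roles of `f` and `g` exchanged.
Functions of fewer than three edges are covered (a function reading only `x, y` reads only `x, y, z`).  Inputs: `FK.apPsi_andSet_nonpos_of_isTTSP`,
`FK.apPsi_pivot_nonpos_of_isTTSP`, `FK.apPsi_pivot_split_nonpos_of_isTTSP` (file 34).  Memo `bschramm/FROM-fk-2-g20-*.md` §1.
[cite: Grimmett2006, §1.4 eq. (1.20) (p. 15); §3.8 Thm. (3.90) (pp. 61–62); §3.9 (pp. 63–64)] [cite: Wagner2006, Thm. 5.8(d), §5.3]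
-/

noncomputable section

namespace Summit.CriticalPhenomena.PercolationContinuityZ3.Theorems

namespace FK

open Literature.Probability.LatticeModels Literature.Probability.Percolation
open scoped Classical

variable {V : Type*}

/-! ### Algebra of the antipodal covariance form -/

section Algebra

/-- `apPsi` is symmetric in its two test functions. [folklore] -/
theorem apPsi_comm (q : ℝ) (H : Finset (Sym2 V)) (f g : Finset (Sym2 V) → ℝ) : apPsi q H f g = apPsi q H g f := by
  unfold apPsi
  exact Finset.sum_congr rfl fun γ _ => by ring

/-- **`apPsi` sees only the odd part of `f`**: two test functions with the same increments `f γ − f(H∖γ)` on the sub-configurations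
of `H` have the same antipodal covariance form against every `g`. [folklore] -/
theorem apPsi_congr_odd (q : ℝ) {H : Finset (Sym2 V)} {f₁ f₂ : Finset (Sym2 V) → ℝ} (g : Finset (Sym2 V) → ℝ)
    (h : ∀ γ : Finset (Sym2 V), γ ⊆ H → f₁ γ - f₁ (H \ γ) = f₂ γ - f₂ (H \ γ)) : apPsi q H f₁ g = apPsi q H f₂ g := by
  unfold apPsi
  exact Finset.sum_congr rfl fun γ hγ => by rw [h γ (Finset.mem_powerset.1 hγ)]

/-- `apPsi` is linear in `f` (four-term form). [folklore] -/
theorem apPsi_lin4_left (q : ℝ) (H : Finset (Sym2 V)) (c₁ c₂ c₃ c₄ : ℝ) (f₁ f₂ f₃ f₄ g : Finset (Sym2 V) → ℝ) :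
    apPsi q H (fun A => c₁ * f₁ A + c₂ * f₂ A + c₃ * f₃ A + c₄ * f₄ A) g =
      c₁ * apPsi q H f₁ g + c₂ * apPsi q H f₂ g + c₃ * apPsi q H f₃ g + c₄ * apPsi q H f₄ g := by
  unfold apPsi
  rw [Finset.mul_sum, Finset.mul_sum, Finset.mul_sum, Finset.mul_sum, ← Finset.sum_add_distrib, ← Finset.sum_add_distrib,
    ← Finset.sum_add_distrib]
  exact Finset.sum_congr rfl fun γ _ => by ring

/-- A function that does not read the edges outside `S` depends only on the trace on `S`: `f A = f (A ∩ S)`. [folklore] -/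
theorem eq_inter_of_notRead_outside {f : Finset (Sym2 V) → ℝ} {S : Finset (Sym2 V)}
    (hf : ∀ e : Sym2 V, e ∉ S → ∀ A : Finset (Sym2 V), f (insert e A) = f A) (A : Finset (Sym2 V)) : f A = f (A ∩ S) := by
  have key : ∀ U : Finset (Sym2 V), (∀ e ∈ U, e ∉ S) → ∀ B : Finset (Sym2 V), f (B ∪ U) = f B := by
    intro U
    induction U using Finset.induction_on with
    | empty => intro _ B; rw [Finset.union_empty]
    | @insert e U _ ih =>
      intro hU B
      rw [Finset.union_insert, hf e (hU e (Finset.mem_insert_self _ _)), ih (fun e' he' => hU e' (Finset.mem_insert_of_mem he')) B]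
  have h := key (A \ S) (fun e he => (Finset.mem_sdiff.1 he).2) (A ∩ S)
  rw [Finset.union_comm, Finset.sdiff_union_inter] at h
  exact h

end Algebra

/-! ### The odd-vector reduction at level 3 -/

section Level3

/-- **THE ODD-VECTOR REDUCTION (level 3).**  For distinct `x, y, z ∈ H` and `f` reading only `x, y, z`,
`apPsi q H f g = (d∅ + dx + dy + dz)·a_{xyz} − dx·a_{yz} − dy·a_{xz} − dz·a_{xy}` with `d∅ = f{x,y,z} − f ∅`, `dx = f{x} − f{y,z}`,
`dy = f{y} − f{x,z}`, `dz = f{z} − f{x,y}` and `a_T = apPsi q H 1_{T ⊆ ·} g`: the odd part of `f` on the eight patterns `γ ∩ {x,y,z}` is that of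
`(d∅+dx+dy+dz)·1_{xyz} − dx·1_{yz} − dy·1_{xz} − dz·1_{xy}` (`FK.apPsi_congr_odd`, `FK.apPsi_lin4_left`).  No monotonicity is used.
[folklore] -/
theorem apPsi_level3_eq (q : ℝ) {H : Finset (Sym2 V)} {x y z : Sym2 V} (hx : x ∈ H) (hy : y ∈ H) (hz : z ∈ H)
    {f : Finset (Sym2 V) → ℝ}
    (hf : ∀ e : Sym2 V, e ∉ ({x, y, z} : Finset (Sym2 V)) → ∀ A : Finset (Sym2 V), f (insert e A) = f A)
    (g : Finset (Sym2 V) → ℝ) :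
    apPsi q H f g =
      (f {x, y, z} - f ∅ + (f {x} - f {y, z}) + (f {y} - f {x, z}) + (f {z} - f {x, y})) *
          apPsi q H (fun A => if ({x, y, z} : Finset (Sym2 V)) ⊆ A then 1 else 0) g -
        (f {x} - f {y, z}) * apPsi q H (fun A => if ({y, z} : Finset (Sym2 V)) ⊆ A then 1 else 0) g -
        (f {y} - f {x, z}) * apPsi q H (fun A => if ({x, z} : Finset (Sym2 V)) ⊆ A then 1 else 0) g -
        (f {z} - f {x, y}) * apPsi q H (fun A => if ({x, y} : Finset (Sym2 V)) ⊆ A then 1 else 0) g := by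
  have hfS := eq_inter_of_notRead_outside hf
  rw [show (f {x, y, z} - f ∅ + (f {x} - f {y, z}) + (f {y} - f {x, z}) + (f {z} - f {x, y})) *
          apPsi q H (fun A => if ({x, y, z} : Finset (Sym2 V)) ⊆ A then 1 else 0) g -
        (f {x} - f {y, z}) * apPsi q H (fun A => if ({y, z} : Finset (Sym2 V)) ⊆ A then 1 else 0) g -
        (f {y} - f {x, z}) * apPsi q H (fun A => if ({x, z} : Finset (Sym2 V)) ⊆ A then 1 else 0) g -
        (f {z} - f {x, y}) * apPsi q H (fun A => if ({x, y} : Finset (Sym2 V)) ⊆ A then 1 else 0) g =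
      apPsi q H (fun A =>
        (f {x, y, z} - f ∅ + (f {x} - f {y, z}) + (f {y} - f {x, z}) + (f {z} - f {x, y})) *
            (if ({x, y, z} : Finset (Sym2 V)) ⊆ A then 1 else 0) +
          (-(f {x} - f {y, z})) * (if ({y, z} : Finset (Sym2 V)) ⊆ A then 1 else 0) +
          (-(f {y} - f {x, z})) * (if ({x, z} : Finset (Sym2 V)) ⊆ A then 1 else 0) +
          (-(f {z} - f {x, y})) * (if ({x, y} : Finset (Sym2 V)) ⊆ A then 1 else 0)) g by
    rw [apPsi_lin4_left]; ring]
  refine apPsi_congr_odd q g fun γ _ => ?_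
  rw [hfS γ, hfS (H \ γ), Finset.inter_comm γ, Finset.inter_comm (H \ γ)]
  by_cases a : x ∈ γ <;> by_cases b : y ∈ γ <;> by_cases c : z ∈ γ <;>
  simp only [Finset.inter_insert, Finset.singleton_inter, Finset.mem_sdiff, hx, hy, hz, a, b, c, Finset.insert_empty,
    Finset.insert_subset_iff, Finset.singleton_subset_iff, and_true, and_false, if_true, if_false,
    not_true_eq_false, not_false_eq_true, and_self] <;> ring

/-- **Theorem U is a relation among AND functionals**: for distinct `x, y, z ∈ H` and any `g`,
`apPsi q H 1_x g = a_{xy} + a_{xz} − a_{yz}` (`a_T = apPsi q H 1_{T ⊆ ·} g`) — `FK.apPsi_level3_eq` for `f = 1_x`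
(`d∅ = dx = 1`, `dy = dz = −1`). [folklore] -/
theorem apPsi_pivot_eq_ands (q : ℝ) {H : Finset (Sym2 V)} {x y z : Sym2 V} (hx : x ∈ H) (hy : y ∈ H) (hz : z ∈ H)
    (hxy : x ≠ y) (hxz : x ≠ z) (g : Finset (Sym2 V) → ℝ) :
    apPsi q H (fun A => if x ∈ A then 1 else 0) g =
      apPsi q H (fun A => if ({x, y} : Finset (Sym2 V)) ⊆ A then 1 else 0) g +
          apPsi q H (fun A => if ({x, z} : Finset (Sym2 V)) ⊆ A then 1 else 0) g -
        apPsi q H (fun A => if ({y, z} : Finset (Sym2 V)) ⊆ A then 1 else 0) g := by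
  have key := apPsi_level3_eq q hx hy hz (f := fun A => if x ∈ A then (1 : ℝ) else 0)
    (fun e he A => by
      have hex : x ≠ e := fun h => he (h ▸ by simp)
      simp only [Finset.mem_insert, hex, false_or]) g
  rw [key]
  simp only [Finset.mem_insert, Finset.mem_singleton, hxy, hxz, or_false, or_self, if_true, if_false, Finset.notMem_empty]
  ring

/-- Moving the split indicator from the `g`-side to the `f`-side: for `y, z ∈ H` the split indicator takes the same value on both
members of a complementary pair, so `apPsi q H 1_x (split_{yz}·g) = apPsi q H (1_x·split_{yz}) g`. [folklore] -/
theorem apPsi_pivot_split_eq_left (q : ℝ) {H : Finset (Sym2 V)} {x y z : Sym2 V} (hy : y ∈ H) (hz : z ∈ H)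
    (g : Finset (Sym2 V) → ℝ) :
    apPsi q H (fun A => if x ∈ A then 1 else 0) (fun A => splitInd y z A * g A) =
      apPsi q H (fun A => (if x ∈ A then 1 else 0) * splitInd y z A) g := by
  unfold apPsi
  refine Finset.sum_congr rfl fun γ _ => ?_
  dsimp only
  rw [TwoSpine.splitInd_compl hy hz]
  ring

/-- **U¹¹ is a relation among AND functionals**: for distinct `x, y, z ∈ H` and any `g`,
`apPsi q H 1_x (split_{yz}·g) = a_{xy} + a_{xz} − 2·a_{xyz}` — `FK.apPsi_level3_eq` for `f = 1_x·split_{yz}` (`d∅ = dx = 0`,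
`dy = dz = −1`).  Gen 16's U¹¹ (`FK.apPsi_pivot_split_nonpos_of_isTTSP`) thus reads `a_{xy} + a_{xz} ≤ 2 a_{xyz}`. [folklore] -/
theorem apPsi_pivot_split_eq_ands (q : ℝ) {H : Finset (Sym2 V)} {x y z : Sym2 V} (hx : x ∈ H) (hy : y ∈ H) (hz : z ∈ H)
    (hxy : x ≠ y) (hxz : x ≠ z) (hyz : y ≠ z) (g : Finset (Sym2 V) → ℝ) :
    apPsi q H (fun A => if x ∈ A then 1 else 0) (fun A => splitInd y z A * g A) =
      apPsi q H (fun A => if ({x, y} : Finset (Sym2 V)) ⊆ A then 1 else 0) g +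
          apPsi q H (fun A => if ({x, z} : Finset (Sym2 V)) ⊆ A then 1 else 0) g -
        2 * apPsi q H (fun A => if ({x, y, z} : Finset (Sym2 V)) ⊆ A then 1 else 0) g := by
  rw [apPsi_pivot_split_eq_left q hy hz]
  have key := apPsi_level3_eq q hx hy hz (f := fun A => (if x ∈ A then (1 : ℝ) else 0) * splitInd y z A)
    (fun e he A => by
      have hex : x ≠ e := fun h => he (h ▸ by simp)
      have hey : e ≠ y := fun h => he (h ▸ by simp)
      have hez : e ≠ z := fun h => he (h ▸ by simp)
      simp only [Finset.mem_insert, hex, false_or, splitInd_insert_of_ne hey hez]) g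
  rw [key]
  unfold splitInd
  simp only [Finset.mem_insert, Finset.mem_singleton, hxy, hxz, hyz, hxy.symm, hxz.symm, hyz.symm, or_true, or_false,
    or_self, if_true, if_false, Finset.notMem_empty, not_true_eq_false, not_false_eq_true, iff_true, iff_false]
  ring

end Level3

/-! ### The level-3 cone (real arithmetic) -/

section Cone

/-- Case `X, Y, Z ≥ 0`, `dx > 0` of the cone lemma. [folklore] -/
private theorem cone_pos_of_pos {P X Y Z d0 dx dy dz : ℝ} (hP : 0 ≤ P) (hY0 : 0 ≤ Y) (hZ0 : 0 ≤ Z)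
    (hUx : X ≤ P + Y + Z) (h0x : |dx| ≤ d0) (hdxy : dx + dy ≤ 0) (hdxz : dx + dz ≤ 0) (hdx : 0 < dx) :
    dx * X + dy * Y + dz * Z ≤ d0 * P := by
  have h1 : dy * Y ≤ -dx * Y := mul_le_mul_of_nonneg_right (by linarith) hY0
  have h2 : dz * Z ≤ -dx * Z := mul_le_mul_of_nonneg_right (by linarith) hZ0
  have h3 : dx * X ≤ dx * (P + Y + Z) := mul_le_mul_of_nonneg_left hUx hdx.le
  have h4 : dx * P ≤ d0 * P := mul_le_mul_of_nonneg_right ((le_abs_self dx).trans h0x) hP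
  nlinarith

/-- Case `X, Y, Z ≥ 0` of the cone lemma. [folklore] -/
private theorem cone_pos {P X Y Z d0 dx dy dz : ℝ} (hP : 0 ≤ P) (hX0 : 0 ≤ X) (hY0 : 0 ≤ Y) (hZ0 : 0 ≤ Z)
    (hUx : X ≤ P + Y + Z) (hUy : Y ≤ P + X + Z) (hUz : Z ≤ P + X + Y)
    (h0x : |dx| ≤ d0) (h0y : |dy| ≤ d0) (h0z : |dz| ≤ d0) (hdxy : dx + dy ≤ 0) (hdxz : dx + dz ≤ 0) (hdyz : dy + dz ≤ 0) :
    dx * X + dy * Y + dz * Z ≤ d0 * P := by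
  have hd0 : 0 ≤ d0 := (abs_nonneg dx).trans h0x
  by_cases hdx : 0 < dx
  · exact cone_pos_of_pos hP hY0 hZ0 hUx h0x hdxy hdxz hdx
  by_cases hdy : 0 < dy
  · have := cone_pos_of_pos (X := Y) (Y := X) (Z := Z) (dx := dy) (dy := dx) (dz := dz) hP hX0 hZ0 hUy h0y
      (by linarith) hdyz hdy
    linarith
  by_cases hdz : 0 < dz
  · have := cone_pos_of_pos (X := Z) (Y := X) (Z := Y) (dx := dz) (dy := dx) (dz := dy) hP hX0 hY0 hUz h0z
      (by linarith) (by linarith) hdz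
    linarith
  push Not at hdx hdy hdz
  nlinarith [mul_nonneg hd0 hP, mul_nonneg (neg_nonneg.2 hdx) hX0, mul_nonneg (neg_nonneg.2 hdy) hY0,
    mul_nonneg (neg_nonneg.2 hdz) hZ0]

/-- Case `X < 0`, `dy > 0` of the cone lemma. [folklore] -/
private theorem cone_neg_of_pos {P X Y Z d0 dx dy dz : ℝ} (hP : 0 ≤ P) (hX : -P ≤ X) (hZ0 : 0 ≤ Z)
    (hUy : Y ≤ P + X + Z) (h0x : |dx| ≤ d0) (hdxy : dx + dy ≤ 0) (hdyz : dy + dz ≤ 0) (hdy : 0 < dy) :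
    dx * X + dy * Y + dz * Z ≤ d0 * P := by
  have h1 : dz * Z ≤ -dy * Z := mul_le_mul_of_nonneg_right (by linarith) hZ0
  have h2 : dy * Y ≤ dy * (P + X + Z) := mul_le_mul_of_nonneg_left hUy hdy.le
  have h3 : (dx + dy) * X ≤ (dx + dy) * (-P) := mul_le_mul_of_nonpos_left hX hdxy
  have h4 : -dx * P ≤ d0 * P := mul_le_mul_of_nonneg_right (by linarith [(abs_le.1 h0x).1]) hP
  nlinarith

/-- Case `X < 0` of the cone lemma (then `Y, Z ≥ -X > 0` by the pair conditions). [folklore] -/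
private theorem cone_neg {P X Y Z d0 dx dy dz : ℝ} (hP : 0 ≤ P) (hX : -P ≤ X) (hXY : 0 ≤ X + Y) (hXZ : 0 ≤ X + Z)
    (hUy : Y ≤ P + X + Z) (hUz : Z ≤ P + X + Y)
    (h0x : |dx| ≤ d0) (hdxy : dx + dy ≤ 0) (hdxz : dx + dz ≤ 0) (hdyz : dy + dz ≤ 0) (hX0 : X < 0) :
    dx * X + dy * Y + dz * Z ≤ d0 * P := by
  have hY0 : 0 ≤ Y := by linarith
  have hZ0 : 0 ≤ Z := by linarith
  have hd0 : 0 ≤ d0 := (abs_nonneg dx).trans h0x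
  by_cases hdy : 0 < dy
  · exact cone_neg_of_pos hP hX hZ0 hUy h0x hdxy hdyz hdy
  by_cases hdz : 0 < dz
  · have := cone_neg_of_pos (X := X) (Y := Z) (Z := Y) (dx := dx) (dy := dz) (dz := dy) hP hX hY0 hUz h0x hdxz
      (by linarith) hdz
    linarith
  push Not at hdy hdz
  have h1 : dy * Y ≤ 0 := mul_nonpos_of_nonpos_of_nonneg hdy hY0
  have h2 : dz * Z ≤ 0 := mul_nonpos_of_nonpos_of_nonneg hdz hZ0
  have h3 : dx * X ≤ d0 * P := by
    by_cases hdx : 0 ≤ dx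
    · nlinarith [mul_nonneg hd0 hP, mul_nonneg hdx (neg_nonneg.2 hX0.le)]
    · push Not at hdx
      have e1 : -dx ≤ d0 := by linarith [(abs_le.1 h0x).1]
      have e2 : -X ≤ P := by linarith
      nlinarith [mul_le_mul e1 e2 (neg_nonneg.2 hX0.le) hd0]
  linarith

/-- **The level-3 cone lemma** (real arithmetic).  With `P = −a_S`, `X = a_S − a_{yz}`, `Y = a_S − a_{xz}`, `Z = a_S − a_{xy}` (twice the
level-3 'drifts' `−D_∅, D_x, D_y, D_z` of memo g19 §11): if `P ≥ 0` (AND₃), `X, Y, Z ≥ −P` (AND₂), `X+Y, X+Z, Y+Z ≥ 0` (U¹¹),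
`X ≤ P+Y+Z`, `Y ≤ P+X+Z`, `Z ≤ P+X+Y` (Theorem U) and the coefficients satisfy `|d_i| ≤ d∅`, `d_i + d_j ≤ 0` (monotonicity of `f`), then
`dx·X + dy·Y + dz·Z ≤ d∅·P`.  Proof: by U¹¹ at most one of `X, Y, Z` is negative; four sign cases, each a two-line estimate. [folklore] -/
theorem level3_cone {P X Y Z d0 dx dy dz : ℝ} (hP : 0 ≤ P) (hX : -P ≤ X) (hY : -P ≤ Y) (hZ : -P ≤ Z)
    (hXY : 0 ≤ X + Y) (hXZ : 0 ≤ X + Z) (hYZ : 0 ≤ Y + Z) (hUx : X ≤ P + Y + Z) (hUy : Y ≤ P + X + Z) (hUz : Z ≤ P + X + Y)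
    (h0x : |dx| ≤ d0) (h0y : |dy| ≤ d0) (h0z : |dz| ≤ d0) (hdxy : dx + dy ≤ 0) (hdxz : dx + dz ≤ 0) (hdyz : dy + dz ≤ 0) :
    dx * X + dy * Y + dz * Z ≤ d0 * P := by
  by_cases hX0 : X < 0
  · exact cone_neg hP hX hXY hXZ hUy hUz h0x hdxy hdxz hdyz hX0
  by_cases hY0 : Y < 0
  · have := cone_neg (X := Y) (Y := X) (Z := Z) (dx := dy) (dy := dx) (dz := dz) hP hY (by linarith) hYZ (by linarith)
      (by linarith) h0y (by linarith) hdyz hdxz hY0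
    linarith
  by_cases hZ0 : Z < 0
  · have := cone_neg (X := Z) (Y := X) (Z := Y) (dx := dz) (dy := dx) (dz := dy) hP hZ (by linarith) (by linarith)
      (by linarith) (by linarith) h0z (by linarith) (by linarith) hdxy hZ0
    linarith
  push Not at hX0 hY0 hZ0
  exact cone_pos hP hX0 hY0 hZ0 hUx hUy hUz h0x h0y h0z hdxy hdxz hdyz

end Cone

/-! ### `C_∞` at level ≤ 3 for every increasing `f` -/

section Main

variable [Fintype V] {s t : V}

/-- **`C_∞` AT LEVEL ≤ 3 FOR EVERY INCREASING `f` (top cell).**  `E` two-terminal series–parallel between `s, t`, `st ∉ E`,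
`x, y, z ∈ H = E ∪ {st}` distinct edges, `0 < q ≤ 1`, `f` increasing on the subsets of `{x,y,z}` and reading no other edge, `g` increasing on
the sub-configurations of `H` and reading none of `x, y, z` ⟹
`apPsi q H f g = Σ_{γ ⊆ H} q^{k(γ)+k(H∖γ)} (f γ − f(H∖γ))(g γ − g(H∖γ)) ≤ 0` — every square-free top coefficient of
`Z_H² · Cov_{φ_{z,q}}(f, g)` is `≤ 0` for EVERY increasing `f` of at most three edges of a 2-connected series–parallel graph (functions of
fewer edges included).  Proof: `FK.apPsi_level3_eq` + `FK.level3_cone`, fed with `FK.apPsi_andSet_nonpos_of_isTTSP` (×4),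
`FK.apPsi_pivot_nonpos_of_isTTSP` (×3, via `FK.apPsi_pivot_eq_ands`) and gen 16's U¹¹ `FK.apPsi_pivot_split_nonpos_of_isTTSP` (×3, via
`FK.apPsi_pivot_split_eq_ands`).
[cite: Grimmett2006, §1.4 eq. (1.20) (p. 15); §3.8 Thm. (3.90) (pp. 61–62); §3.9 (pp. 63–64)] [cite: Wagner2006, Thm. 5.8(d), §5.3] -/
theorem apPsi_level3_nonpos_of_isTTSP {q : ℝ} (hq0 : 0 < q) (hq1 : q ≤ 1) {E : Finset (Sym2 V)} (hE : IsTTSP E s t)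
    (hst : s(s, t) ∉ E) {x y z : Sym2 V} (hx : x ∈ insert s(s, t) E) (hy : y ∈ insert s(s, t) E) (hz : z ∈ insert s(s, t) E)
    (hxy : x ≠ y) (hxz : x ≠ z) (hyz : y ≠ z) {f g : Finset (Sym2 V) → ℝ}
    (hf : ∀ e : Sym2 V, e ∉ ({x, y, z} : Finset (Sym2 V)) → ∀ A : Finset (Sym2 V), f (insert e A) = f A)
    (hfmono : ∀ ⦃A B : Finset (Sym2 V)⦄, A ⊆ B → B ⊆ ({x, y, z} : Finset (Sym2 V)) → f A ≤ f B)
    (hgx : ∀ A : Finset (Sym2 V), g (insert x A) = g A) (hgy : ∀ A : Finset (Sym2 V), g (insert y A) = g A)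
    (hgz : ∀ A : Finset (Sym2 V), g (insert z A) = g A)
    (hmono : ∀ ⦃A B : Finset (Sym2 V)⦄, A ⊆ B → B ⊆ insert s(s, t) E → g A ≤ g B) :
    apPsi q (insert s(s, t) E) f g ≤ 0 := by
  set H := insert s(s, t) E with hH
  -- the four AND functionals and their signs
  have hS3 : ({x, y, z} : Finset (Sym2 V)) ⊆ H := by simp [Finset.insert_subset_iff, hx, hy, hz]
  have hSxy : ({x, y} : Finset (Sym2 V)) ⊆ H := by simp [Finset.insert_subset_iff, hx, hy]
  have hSxz : ({x, z} : Finset (Sym2 V)) ⊆ H := by simp [Finset.insert_subset_iff, hx, hz]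
  have hSyz : ({y, z} : Finset (Sym2 V)) ⊆ H := by simp [Finset.insert_subset_iff, hy, hz]
  have ng3 : ∀ e ∈ ({x, y, z} : Finset (Sym2 V)), ∀ A : Finset (Sym2 V), g (insert e A) = g A := by
    intro e he A; simp only [Finset.mem_insert, Finset.mem_singleton] at he
    rcases he with rfl | rfl | rfl
    exacts [hgx A, hgy A, hgz A]
  have ngxy : ∀ e ∈ ({x, y} : Finset (Sym2 V)), ∀ A : Finset (Sym2 V), g (insert e A) = g A := fun e he A =>
    ng3 e (by simp only [Finset.mem_insert, Finset.mem_singleton] at he ⊢; tauto) A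
  have ngxz : ∀ e ∈ ({x, z} : Finset (Sym2 V)), ∀ A : Finset (Sym2 V), g (insert e A) = g A := fun e he A =>
    ng3 e (by simp only [Finset.mem_insert, Finset.mem_singleton] at he ⊢; tauto) A
  have ngyz : ∀ e ∈ ({y, z} : Finset (Sym2 V)), ∀ A : Finset (Sym2 V), g (insert e A) = g A := fun e he A =>
    ng3 e (by simp only [Finset.mem_insert, Finset.mem_singleton] at he ⊢; tauto) A
  have aS := apPsi_andSet_nonpos_of_isTTSP hq0 hq1 hE hst hS3 ⟨x, by simp⟩ ng3 hmono
  have axy := apPsi_andSet_nonpos_of_isTTSP hq0 hq1 hE hst hSxy ⟨x, by simp⟩ ngxy hmono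
  have axz := apPsi_andSet_nonpos_of_isTTSP hq0 hq1 hE hst hSxz ⟨x, by simp⟩ ngxz hmono
  have ayz := apPsi_andSet_nonpos_of_isTTSP hq0 hq1 hE hst hSyz ⟨y, by simp⟩ ngyz hmono
  -- Theorem U at x, y, z as relations among the AND functionals
  have ux := apPsi_pivot_nonpos_of_isTTSP hq0 hq1 hE hst hx hgx hmono
  have uy := apPsi_pivot_nonpos_of_isTTSP hq0 hq1 hE hst hy hgy hmono
  have uz := apPsi_pivot_nonpos_of_isTTSP hq0 hq1 hE hst hz hgz hmono
  rw [apPsi_pivot_eq_ands q hx hy hz hxy hxz] at ux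
  rw [apPsi_pivot_eq_ands q hy hx hz hxy.symm hyz, Finset.pair_comm y x] at uy
  rw [apPsi_pivot_eq_ands q hz hx hy hxz.symm hyz.symm, Finset.pair_comm z x, Finset.pair_comm z y] at uz
  -- U¹¹ at x, y, z as relations among the AND functionals
  have vx := apPsi_pivot_split_nonpos_of_isTTSP hq0 hq1 hE hst hx hy hz hxy hxz hyz hgx hgy hgz hmono
  have vy := apPsi_pivot_split_nonpos_of_isTTSP hq0 hq1 hE hst hy hx hz hxy.symm hyz hxz hgy hgx hgz hmono
  have vz := apPsi_pivot_split_nonpos_of_isTTSP hq0 hq1 hE hst hz hx hy hxz.symm hyz.symm hxy hgz hgx hgy hmono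
  rw [apPsi_pivot_split_eq_ands q hx hy hz hxy hxz hyz] at vx
  rw [apPsi_pivot_split_eq_ands q hy hx hz hxy.symm hyz hxz, Finset.pair_comm y x, Finset.insert_comm y x] at vy
  rw [apPsi_pivot_split_eq_ands q hz hx hy hxz.symm hyz.symm hxy, Finset.pair_comm z x, Finset.pair_comm z y,
    Finset.insert_comm z x, Finset.pair_comm z y] at vz
  -- monotonicity of f on the subsets of {x, y, z}
  have sub : ∀ A : Finset (Sym2 V), (∀ e ∈ A, e = x ∨ e = y ∨ e = z) → A ⊆ ({x, y, z} : Finset (Sym2 V)) := fun A hA e he => by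
    simp only [Finset.mem_insert, Finset.mem_singleton]; exact hA e he
  have m1 : f {x} ≤ f {x, y, z} := hfmono (by intro e; simp only [Finset.mem_insert, Finset.mem_singleton]; tauto) (sub _ (by simp))
  have m2 : f ∅ ≤ f {y, z} := hfmono (Finset.empty_subset _) (sub _ (by simp))
  have m3 : f {y, z} ≤ f {x, y, z} := hfmono (by intro e; simp only [Finset.mem_insert, Finset.mem_singleton]; tauto) (sub _ (by simp))
  have m4 : f ∅ ≤ f {x} := hfmono (Finset.empty_subset _) (sub _ (by simp))
  have m5 : f {y} ≤ f {x, y, z} := hfmono (by intro e; simp only [Finset.mem_insert, Finset.mem_singleton]; tauto) (sub _ (by simp))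
  have m6 : f ∅ ≤ f {x, z} := hfmono (Finset.empty_subset _) (sub _ (by simp))
  have m7 : f {x, z} ≤ f {x, y, z} := hfmono (by intro e; simp only [Finset.mem_insert, Finset.mem_singleton]; tauto) (sub _ (by simp))
  have m8 : f ∅ ≤ f {y} := hfmono (Finset.empty_subset _) (sub _ (by simp))
  have m9 : f {z} ≤ f {x, y, z} := hfmono (by intro e; simp only [Finset.mem_insert, Finset.mem_singleton]; tauto) (sub _ (by simp))
  have m10 : f ∅ ≤ f {x, y} := hfmono (Finset.empty_subset _) (sub _ (by simp))
  have m11 : f {x, y} ≤ f {x, y, z} := hfmono (by intro e; simp only [Finset.mem_insert, Finset.mem_singleton]; tauto) (sub _ (by simp))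
  have m12 : f ∅ ≤ f {z} := hfmono (Finset.empty_subset _) (sub _ (by simp))
  have n1 : f {x} ≤ f {x, y} := hfmono (by intro e; simp only [Finset.mem_insert, Finset.mem_singleton]; tauto) (sub _ (by simp))
  have n2 : f {x} ≤ f {x, z} := hfmono (by intro e; simp only [Finset.mem_insert, Finset.mem_singleton]; tauto) (sub _ (by simp))
  have n3 : f {y} ≤ f {x, y} := hfmono (by intro e; simp only [Finset.mem_insert, Finset.mem_singleton]; tauto) (sub _ (by simp))
  have n4 : f {y} ≤ f {y, z} := hfmono (by intro e; simp only [Finset.mem_insert, Finset.mem_singleton]; tauto) (sub _ (by simp))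
  have n5 : f {z} ≤ f {x, z} := hfmono (by intro e; simp only [Finset.mem_insert, Finset.mem_singleton]; tauto) (sub _ (by simp))
  have n6 : f {z} ≤ f {y, z} := hfmono (by intro e; simp only [Finset.mem_insert, Finset.mem_singleton]; tauto) (sub _ (by simp))
  rw [apPsi_level3_eq q hx hy hz hf g]
  have key := level3_cone (P := - apPsi q H (fun A => if ({x, y, z} : Finset (Sym2 V)) ⊆ A then 1 else 0) g)
    (X := apPsi q H (fun A => if ({x, y, z} : Finset (Sym2 V)) ⊆ A then 1 else 0) g -
      apPsi q H (fun A => if ({y, z} : Finset (Sym2 V)) ⊆ A then 1 else 0) g)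
    (Y := apPsi q H (fun A => if ({x, y, z} : Finset (Sym2 V)) ⊆ A then 1 else 0) g -
      apPsi q H (fun A => if ({x, z} : Finset (Sym2 V)) ⊆ A then 1 else 0) g)
    (Z := apPsi q H (fun A => if ({x, y, z} : Finset (Sym2 V)) ⊆ A then 1 else 0) g -
      apPsi q H (fun A => if ({x, y} : Finset (Sym2 V)) ⊆ A then 1 else 0) g)
    (d0 := f {x, y, z} - f ∅) (dx := f {x} - f {y, z}) (dy := f {y} - f {x, z}) (dz := f {z} - f {x, y})
    (by linarith) (by linarith) (by linarith) (by linarith) (by linarith) (by linarith) (by linarith)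
    (by linarith) (by linarith) (by linarith)
    (abs_le.2 ⟨by linarith, by linarith⟩) (abs_le.2 ⟨by linarith, by linarith⟩) (abs_le.2 ⟨by linarith, by linarith⟩)
    (by linarith) (by linarith) (by linarith)
  linarith

/-- **`C_∞` at level ≤ 3, the roles exchanged**: `f` increasing on the sub-configurations of `H` reading none of `x, y, z`, and `g`
increasing reading only `x, y, z` ⟹ `apPsi q H f g ≤ 0` (`FK.apPsi_comm`).  Together with `FK.apPsi_level3_nonpos_of_isTTSP`:
Conjecture `C_∞` holds at the top cell whenever `min(|supp f|, |supp g|) ≤ 3`.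
[cite: Grimmett2006, §3.8 Thm. (3.90) (pp. 61–62); §3.9 (pp. 63–64)] [cite: Wagner2006, Thm. 5.8(d), §5.3] -/
theorem apPsi_level3_nonpos_of_isTTSP' {q : ℝ} (hq0 : 0 < q) (hq1 : q ≤ 1) {E : Finset (Sym2 V)} (hE : IsTTSP E s t)
    (hst : s(s, t) ∉ E) {x y z : Sym2 V} (hx : x ∈ insert s(s, t) E) (hy : y ∈ insert s(s, t) E) (hz : z ∈ insert s(s, t) E)
    (hxy : x ≠ y) (hxz : x ≠ z) (hyz : y ≠ z) {f g : Finset (Sym2 V) → ℝ}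
    (hfx : ∀ A : Finset (Sym2 V), f (insert x A) = f A) (hfy : ∀ A : Finset (Sym2 V), f (insert y A) = f A)
    (hfz : ∀ A : Finset (Sym2 V), f (insert z A) = f A)
    (hfmono : ∀ ⦃A B : Finset (Sym2 V)⦄, A ⊆ B → B ⊆ insert s(s, t) E → f A ≤ f B)
    (hg : ∀ e : Sym2 V, e ∉ ({x, y, z} : Finset (Sym2 V)) → ∀ A : Finset (Sym2 V), g (insert e A) = g A)
    (hgmono : ∀ ⦃A B : Finset (Sym2 V)⦄, A ⊆ B → B ⊆ ({x, y, z} : Finset (Sym2 V)) → g A ≤ g B) :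
    apPsi q (insert s(s, t) E) f g ≤ 0 := by
  rw [apPsi_comm]
  exact apPsi_level3_nonpos_of_isTTSP hq0 hq1 hE hst hx hy hz hxy hxz hyz hg hgmono hfx hfy hfz hfmono

end Main

end FK

end Summit.CriticalPhenomena.PercolationContinuityZ3.Theorems

end
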